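import Literature.Topology.FourManifolds.PageSystemBinding
import Literature.AlgebraicTopology.SingularHomology.LocallyFlatCriticalDegree
import Literature.AlgebraicTopology.SingularHomology.LocallyFlatComplement
import Literature.AlgebraicTopology.SingularHomology.BoundaryComplementHomology
import Literature.AlgebraicTopology.SingularHomology.CircleProductHomology
import Literature.AlgebraicTopology.SingularHomology.BoundaryManifoldFiniteness
import Literature.AlgebraicTopology.SingularHomology.IntersectionFormProofs
import Literature.AlgebraicTopology.SingularHomology.MayerVietorisBettiOne
import Literature.AlgebraicTopology.SingularHomology.ExcisionMayerVietorisProofs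
import HarnessLib

/-!
# `b₁(M; ℚ) = b₁(P)` for a closed 3-manifold whose open book is trivialised by a page `P` with
# connected boundary

Topic `Literature/Topology/FourManifolds`; proof file (theorems only, no definitions, no named
facts): the dictionary sub-lemma (E-d) `IsPageSystem.finrank_singularHomology_one_eq_bettiNumber`
of fact E (`length_eq_bettiNumber_of_isLefschetzHandlebodyOver`, `LefschetzHandlebodyEuler.lean`;
its named-fact form there is `finrank_singularHomology_one_eq_bettiNumber_of_isPageSystem`).
Etnyre–Fuller 2006, §2 / Gompf–Stipsicz 1999, §8.2 / Etnyre 2006, §2: the open book `(P, id)`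
has `H₁ = H₁(P)`; in the tree's vocabulary (`IsPageSystem ob J`, `AchiralLefschetzModel.lean`):
if the open book `ob` of the closed `3`-manifold `M` is trivialised off the binding by a page
system `J : P × ℝ → M` and the compact connected surface `P` has CONNECTED boundary, then
`dim H₁(M; ℚ) = b₁(P)`.  (False for disconnected `∂P`: `PlanarLefschetzBodyCounterexample.lean`.)

Proof (orientation-free).  Let `B` be the binding and `U = M ∖ B`.
1. `U ≅ int P × S¹` (`IsPageSystem.exists_homeomorph`), so by the Künneth splitting
   `H₁(int P × S¹) ≅ H₁(int P) ⊕ H₀(int P)` (`nonempty_singularHomology_prodCircle_equiv_succ`) and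
   `H_*(int P) ≅ H_*(P)` (`isIso_singularHomology_map_interior_of_compactSpace`):
   `dim H₁(U; ℚ) = b₁(P) + 1` (`IsPageSystem.finrank_singularHomology_compl_binding_one`).
2. `B` is connected (`IsPageSystem.isPreconnected_binding`, this is where `∂P` connected enters)
   and locally flat of codimension `2` (the tubes straighten it, `OpenBook.exists_straightening`),
   so `H₁(U) → H₁(M)` is onto (`surjective_injective_map_compl_of_locallyFlat`, Kosinski X.1.1) and
   `H₂(M, U; ℚ)` is spanned by one class (`exists_forall_mem_span_localHomologyOfSet_of_locallyFlat`,
   the topological Thom class).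
3. The meridian `μ = [x ↦ tube i (x₀, x)] ∈ H₁(U; ℚ)` is nonzero (`ob.proj ∘ μ = id_{S¹}` by the
   normal form `proj (tube i (x, w)) = w/‖w‖`, and `H₁(S¹; ℚ) ≠ 0`) and dies in `H₁(M)` (it bounds
   the meridional disc `w ↦ tube i (x₀, w)`): `OpenBook.exists_meridian_class`.
4. Exactness of `H₂(M, U) → H₁(U) → H₁(M) → 0` and rank–nullity: the kernel has dimension
   exactly `1`, so `dim H₁(M; ℚ) = (b₁(P) + 1) - 1 = b₁(P; ℚ) = bettiNumber ℤ P 1`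
   (`bettiNumber_int_eq_rat`).

## References

* J. B. Etnyre, T. Fuller, *Realizing 4-manifolds as achiral Lefschetz fibrations*, IMRN 2006, §2.
  [EtnyreFuller2006]
* R. E. Gompf, A. I. Stipsicz, *4-Manifolds and Kirby Calculus*, GSM 20 (1999), §8.2.
  [GompfStipsiczGSM1999]
* A. Kosinski, *Differential Manifolds* (1993), X.1 Prop. (1.1). [Kosinski1993]
-/

noncomputable section

open scoped Manifold ContDiff Topology
open Set Filter Function Topology CategoryTheory CategoryTheory.Limits
open Literature.AlgebraicTopology.SingularHomology

namespace Literature.Topology.FourManifolds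

/-! ### The binding is locally flat of codimension `2` -/

section Straightening

variable {M : Type*} [TopologicalSpace M] [ChartedSpace (EuclideanSpace ℝ (Fin 3)) M]
  [IsManifold (𝓡 3) ∞ M]

/-- **The tubes straighten the binding**: at the binding point `tube i (x, 0)` the chart
`tube i (x', w) ↦ (w, φ x')` of `M` (`φ` a chart of the circle at `x`), defined on
`tube i (φ.source × ℝ²)`, is an open partial homeomorphism `M ⇀ ℝ² × ℝ¹` in which the binding
reads `{w = 0}` (the binding meets the tube exactly in its core). [folklore] -/
theorem _root_.Literature.Geometry.Symplectic.OpenBook.exists_straightening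
    (ob : Literature.Geometry.Symplectic.OpenBook M) (i : Fin ob.k)
    (x : Metric.sphere (0 : EuclideanSpace ℝ (Fin 2)) 1) :
    ∃ e : OpenPartialHomeomorph M (EuclideanSpace ℝ (Fin 2) × EuclideanSpace ℝ (Fin 1)),
      ob.tube i (x, 0) ∈ e.source ∧ ∀ z ∈ e.source, z ∈ ob.binding ↔ (e z).1 = 0 := by
  haveI : Nonempty (Metric.sphere (0 : EuclideanSpace ℝ (Fin 2)) 1 × EuclideanSpace ℝ (Fin 2)) :=
    ⟨(x, 0)⟩
  have hT : IsOpenEmbedding (ob.tube i) :=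
    ⟨(ob.isSmoothEmbedding_tube i).isEmbedding, ob.isOpen_range_tube i⟩
  set T := hT.toOpenPartialHomeomorph (ob.tube i)
  set ch := chartAt (EuclideanSpace ℝ (Fin 1)) x
  refine ⟨T.symm.trans ((ch.prod (OpenPartialHomeomorph.refl _)).transHomeomorph
    (Homeomorph.prodComm _ _)), ?_, ?_⟩
  · rw [OpenPartialHomeomorph.trans_source, OpenPartialHomeomorph.symm_source,
      hT.toOpenPartialHomeomorph_target]
    refine ⟨⟨(x, 0), rfl⟩, ?_⟩
    rw [mem_preimage, OpenPartialHomeomorph.transHomeomorph_source,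
      OpenPartialHomeomorph.prod_source, hT.toOpenPartialHomeomorph_left_inv]
    exact ⟨mem_chart_source _ x, mem_univ _⟩
  · intro z hz
    rw [OpenPartialHomeomorph.trans_source, OpenPartialHomeomorph.symm_source,
      hT.toOpenPartialHomeomorph_target] at hz
    obtain ⟨⟨⟨x', w⟩, rfl⟩, -⟩ := hz
    rw [ob.tube_mem_binding_iff, OpenPartialHomeomorph.trans_apply,
      hT.toOpenPartialHomeomorph_left_inv]
    exact Iff.rfl

/-- **The binding is locally flat of codimension `2`**, in the straightening-chart form consumed by
the tree's complement/local-homology engines (`LocallyFlatComplement.lean`,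
`LocallyFlatCriticalDegree.lean`). [folklore] -/
theorem _root_.Literature.Geometry.Symplectic.OpenBook.locallyFlat_binding
    (ob : Literature.Geometry.Symplectic.OpenBook M) :
    ∀ b ∈ ob.binding, ∃ (F : Type) (_ : NormedAddCommGroup F) (_ : NormedSpace ℝ F)
      (_ : FiniteDimensional ℝ F) (K : Type) (_ : NormedAddCommGroup K) (_ : NormedSpace ℝ K)
      (e : OpenPartialHomeomorph M (F × K)),
      2 ≤ Module.finrank ℝ F ∧ b ∈ e.source ∧ ∀ z ∈ e.source, z ∈ ob.binding ↔ (e z).1 = 0 := by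
  intro b hb
  obtain ⟨i, x, rfl⟩ := (ob.mem_binding_iff b).1 hb
  obtain ⟨e, hbe, he⟩ := ob.exists_straightening i x
  exact ⟨EuclideanSpace ℝ (Fin 2), inferInstance, inferInstance, inferInstance,
    EuclideanSpace ℝ (Fin 1), inferInstance, inferInstance, e, by simp, hbe, he⟩

end Straightening

/-! ### Homology of the binding complement: surjectivity, the Thom class, the meridian -/

section Complement

variable {M : Type} [TopologicalSpace M] [T2Space M] [SecondCountableTopology M]
  [ChartedSpace (EuclideanSpace ℝ (Fin 3)) M] [IsManifold (𝓡 3) ∞ M]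

/-- **`H₁(M ∖ B; R) → H₁(M; R)` is onto** (the binding is a closed, locally flat subset of
codimension `2`; Kosinski 1993, X.1 Prop. (1.1), via the tree's
`surjective_injective_map_compl_of_locallyFlat`). [cite: Kosinski1993, X.1 Prop. (1.1)] -/
theorem _root_.Literature.Geometry.Symplectic.OpenBook.surjective_map_compl_binding_one
    (R : Type) [CommRing R] (ob : Literature.Geometry.Symplectic.OpenBook M) :
    Surjective (singularHomology.map R R (subsetIncl (ob.binding)ᶜ) 1) :=
  (surjective_injective_map_compl_of_locallyFlat R R ob.isClosed_binding 2
    ob.locallyFlat_binding).1 1 one_lt_two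

/-- **The local homology `H₂(M, M ∖ B; R)` at a CONNECTED binding is spanned by one class** (the
topological Thom class; the tree's `exists_forall_mem_span_localHomologyOfSet_of_locallyFlat`).
[folklore] -/
theorem _root_.Literature.Geometry.Symplectic.OpenBook.exists_forall_mem_span_localHomology_two
    (R : Type) [CommRing R] (ob : Literature.Geometry.Symplectic.OpenBook M)
    (h : IsPreconnected ob.binding) :
    ∃ θ : localHomologyOfSet R R M ob.binding 2, ∀ x, x ∈ Submodule.span R ({θ} : Set _) :=
  exists_forall_mem_span_localHomologyOfSet_of_locallyFlat R ob.isClosed_binding h le_rfl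
    ob.locallyFlat_binding

omit [T2Space M] [SecondCountableTopology M] in
/-- **The meridian of a binding tube is a nonzero class of `H₁(M ∖ B; ℚ)` dying in `H₁(M; ℚ)`.**
The loop `x ↦ tube i (x₀, x)` (`x ∈ S¹ ⊆ ℝ²`) lies off the binding; `ob.proj` restricts on it
to the identity of `S¹` (normal form `proj (tube i (x, w)) = w/‖w‖`), so it carries the
generator of `H₁(S¹; ℚ) ≅ ℚ` to a nonzero class; in `M` it factors through the meridional disc
`w ↦ tube i (x₀, w)`, `ℝ²` being contractible. [cite: EtnyreFuller2006, §2] -/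
theorem _root_.Literature.Geometry.Symplectic.OpenBook.exists_meridian_class
    (ob : Literature.Geometry.Symplectic.OpenBook M) (i : Fin ob.k)
    (x₀ : Metric.sphere (0 : EuclideanSpace ℝ (Fin 2)) 1) :
    ∃ μ : singularHomology ℚ ℚ ↥(ob.binding)ᶜ 1,
      μ ≠ 0 ∧ singularHomology.map ℚ ℚ (subsetIncl (ob.binding)ᶜ) 1 μ = 0 := by
  -- the meridian loop, the angular map, the meridional disc, the circle inclusion
  have hmem : ∀ x : Metric.sphere (0 : EuclideanSpace ℝ (Fin 2)) 1,
      ob.tube i (x₀, (x : EuclideanSpace ℝ (Fin 2))) ∈ (ob.binding)ᶜ := fun x h =>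
    ne_zero_of_mem_unit_sphere x ((ob.tube_mem_binding_iff i x₀ _).1 h)
  let γ : C(Metric.sphere (0 : EuclideanSpace ℝ (Fin 2)) 1, ↥(ob.binding)ᶜ) :=
    ⟨fun x => ⟨ob.tube i (x₀, (x : EuclideanSpace ℝ (Fin 2))), hmem x⟩,
      ((ob.continuous_tube i).comp (by fun_prop)).subtype_mk _⟩
  let ρ : C(↥(ob.binding)ᶜ, Metric.sphere (0 : EuclideanSpace ℝ (Fin 2)) 1) :=
    ⟨fun y => ob.proj y, ob.contMDiffOn_proj.continuousOn.comp_continuous continuous_subtype_val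
      fun y => y.2⟩
  let D : C(EuclideanSpace ℝ (Fin 2), M) :=
    ⟨fun w => ob.tube i (x₀, w), (ob.continuous_tube i).comp (by fun_prop)⟩
  let ι : C(Metric.sphere (0 : EuclideanSpace ℝ (Fin 2)) 1, EuclideanSpace ℝ (Fin 2)) :=
    ⟨Subtype.val, continuous_subtype_val⟩
  have hργ : ρ.comp γ = ContinuousMap.id _ := by
    ext x : 1
    apply Subtype.ext
    change (ob.proj (ob.tube i (x₀, x.1))).1 = x.1
    rw [ob.proj_tube i x₀ _ (ne_zero_of_mem_unit_sphere x), norm_eq_of_mem_sphere, inv_one,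
      one_smul]
  have hιγ : (subsetIncl (ob.binding)ᶜ).comp γ = D.comp ι := by
    ext x : 1
    rfl
  -- a generator of `H₁(S¹; ℚ)`
  obtain ⟨e⟩ := nonempty_singularHomology_sphere_iso_holds ℚ ℚ (n := 1) le_rfl
  set g : singularHomology ℚ ℚ (Metric.sphere (0 : EuclideanSpace ℝ (Fin 2)) 1) 1 :=
    e.inv (ULift.up 1) with hg
  have hg0 : g ≠ 0 := by
    intro h0
    have h1 : e.hom g = ULift.up 1 := by
      rw [hg, ← ModuleCat.comp_apply, e.inv_hom_id]; rfl
    rw [h0, map_zero] at h1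
    exact one_ne_zero (congrArg ULift.down h1).symm
  refine ⟨singularHomology.map ℚ ℚ γ 1 g, fun h0 => hg0 ?_, ?_⟩
  · -- `ρ_* γ_* = id`, so `γ_* g = 0` forces `g = 0`
    have h1 : singularHomology.map ℚ ℚ ρ 1 (singularHomology.map ℚ ℚ γ 1 g) = g := by
      rw [← ModuleCat.comp_apply, ← singularHomology.map_comp, hργ, singularHomology.map_id]
      rfl
    rw [← h1, h0, map_zero]
  · -- `incl_* γ_* = D_* ι_*` factors through `H₁(ℝ²; ℚ) = 0`
    rw [← ModuleCat.comp_apply, ← singularHomology.map_comp, hιγ, singularHomology.map_comp,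
      ModuleCat.comp_apply]
    have hz : IsZero (singularHomology ℚ ℚ (EuclideanSpace ℝ (Fin 2)) 1) :=
      isZero_singularHomology_of_contractibleSpace ℚ ℚ one_ne_zero
    rw [hz.eq_zero_of_tgt (singularHomology.map ℚ ℚ ι 1)]
    simp

end Complement

/-! ### `dim H₁(M ∖ B; ℚ) = b₁(P) + 1` and the theorem -/

section PageSystem

variable {P : Type} [TopologicalSpace P] [T2Space P] [CompactSpace P]
  [ChartedSpace (EuclideanHalfSpace 2) P] [IsManifold (𝓡∂ 2) ∞ P]
  {M : Type} [TopologicalSpace M] [T2Space M]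
  [ChartedSpace (EuclideanSpace ℝ (Fin 3)) M] [IsManifold (𝓡 3) ∞ M]
  {ob : Literature.Geometry.Symplectic.OpenBook M} {J : P × ℝ → M}

/-- **The interior of a compact surface carries its homology**: `Hₖ(int P; R) ≃ Hₖ(P; R)`
(the tree's `isIso_singularHomology_map_interior_of_compactSpace`, Hatcher 2002, Prop. 3.42, read
on `int P = (∂P)ᶜ`). [folklore] -/
theorem nonempty_linearEquiv_singularHomology_interior (R : Type) [CommRing R] (k : ℕ) :
    Nonempty (singularHomology R R ↥((𝓡∂ 2).interior P) k ≃ₗ[R] singularHomology R R P k) := by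
  let e₁ : ↥((𝓡∂ 2).interior P) ≃ₜ ↥((𝓡∂ 2).boundary P)ᶜ :=
    Homeomorph.setCongr (ModelWithCorners.compl_boundary (I := 𝓡∂ 2) (M := P)).symm
  haveI := isIso_singularHomology_map_interior_of_compactSpace R R (X := P) (n := 1) (m := ∞)
    (by simp) k
  exact ⟨(singularHomology.mapIso R R e₁ k ≪≫
    asIso (singularHomology.map R R (subsetIncl ((𝓡∂ 2).boundary P)ᶜ) k)).toLinearEquiv⟩

/-- **`dim H₁(M ∖ B; ℚ) = dim H₁(P; ℚ) + 1`** (and `H₁(M ∖ B; ℚ)` is finite dimensional) for a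
page system by a compact connected surface `P`: `M ∖ B ≅ int P × S¹` (`exists_homeomorph`),
the Künneth splitting `H₁(int P × S¹) ≅ H₁(int P) ⊕ H₀(int P)` (Hatcher 2002, Cor. 3B.7; the tree's
`nonempty_singularHomology_prodCircle_equiv_succ`), `H_*(int P) ≅ H_*(P)`, `H₀(P; ℚ) ≅ ℚ`.
[cite: EtnyreFuller2006, §2] -/
theorem IsPageSystem.finrank_singularHomology_compl_binding_one [ConnectedSpace P]
    (hJ : IsPageSystem ob J) :
    Module.finrank ℚ (singularHomology ℚ ℚ ↥(ob.binding)ᶜ 1) =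
        Module.finrank ℚ (singularHomology ℚ ℚ P 1) + 1 ∧
      Module.Finite ℚ (singularHomology ℚ ℚ ↥(ob.binding)ᶜ 1) := by
  obtain ⟨Φ, -⟩ := hJ.exists_homeomorph
  obtain ⟨e₂⟩ := nonempty_singularHomology_prodCircle_equiv_succ ℚ ℚ (K := ↥((𝓡∂ 2).interior P)) 0
  obtain ⟨f₁⟩ := nonempty_linearEquiv_singularHomology_interior (P := P) ℚ 1
  obtain ⟨f₀⟩ := nonempty_linearEquiv_singularHomology_interior (P := P) ℚ 0
  haveI : PathConnectedSpace P := by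
    haveI := ChartedSpace.locallyPathConnectedSpace (EuclideanHalfSpace 2) P
    exact pathConnectedSpace_iff_connectedSpace.2 inferInstance
  let e : singularHomology ℚ ℚ ↥(ob.binding)ᶜ 1 ≃ₗ[ℚ] singularHomology ℚ ℚ P 1 × ℚ :=
    (singularHomology.mapIso ℚ ℚ Φ.symm 1).toLinearEquiv ≪≫ₗ e₂ ≪≫ₗ
      LinearEquiv.prodCongr f₁ (f₀ ≪≫ₗ singularHomology.zeroLinearEquivOfPathConnected ℚ ℚ P)
  haveI : Module.Finite ℚ (singularHomology ℚ ℚ P 1) :=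
    finite_singularHomology_of_compact_chartedSpace_halfSpace ℚ ℚ (n := 1) 1
  refine ⟨?_, Module.Finite.equiv e.symm⟩
  rw [e.finrank_eq, Module.finrank_prod, Module.finrank_self]

end PageSystem

/-! ### The theorem -/

/-- **First Betti number of a closed `3`-manifold whose open book is trivialised by a page with
connected boundary** (Etnyre–Fuller 2006, §2; Gompf–Stipsicz 1999, §8.2; Etnyre 2006, §2:
`H₁` of the open book `(P, id)` is `H₁(P)`): if `ob` is trivialised off its binding by the page
system `J : P × ℝ → M` (`IsPageSystem ob J`), `P` a compact connected surface with CONNECTED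
boundary, then `dim_ℚ H₁(M; ℚ) = bettiNumber ℤ P 1`.  Proof: `dim H₁(M ∖ B) = b₁(P) + 1`
(`finrank_singularHomology_compl_binding_one`); the binding is connected
(`isPreconnected_binding`) and locally flat of codimension `2`, so `H₁(M ∖ B) → H₁(M)` is onto
and `H₂(M, M ∖ B; ℚ)` is spanned by one class; the meridian is a nonzero class of the kernel
(`OpenBook.exists_meridian_class`); exactness of `H₂(M, M ∖ B) → H₁(M ∖ B) → H₁(M)` and
rank–nullity give `dim H₁(M) = b₁(P) + 1 - 1`; finally `b₁(P; ℚ) = bettiNumber ℤ P 1`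
(`bettiNumber_int_eq_rat`).  False without the connected-boundary hypothesis
(`PlanarLefschetzBodyCounterexample.lean`). [cite: EtnyreFuller2006, §2] -/
theorem IsPageSystem.finrank_singularHomology_one_eq_bettiNumber
    {P : Type} [TopologicalSpace P] [T2Space P] [SecondCountableTopology P] [CompactSpace P]
    [ConnectedSpace P] [ChartedSpace (EuclideanHalfSpace 2) P] [IsManifold (𝓡∂ 2) ∞ P]
    (hP : ConnectedSpace ↥((𝓡∂ 2).boundary P))
    {M : Type} [TopologicalSpace M] [T2Space M] [SecondCountableTopology M] [CompactSpace M]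
    [ChartedSpace (EuclideanSpace ℝ (Fin 3)) M] [IsManifold (𝓡 3) ∞ M]
    {ob : Literature.Geometry.Symplectic.OpenBook M} {J : P × ℝ → M} (hJ : IsPageSystem ob J) :
    Module.finrank ℚ (singularHomology ℚ ℚ M 1) = bettiNumber ℤ P 1 := by
  -- (1) `dim H₁(M ∖ B) = b₁(P) + 1`
  obtain ⟨hdimU, hfinU⟩ := hJ.finrank_singularHomology_compl_binding_one
  haveI := hfinU
  -- (2) connected, locally flat binding: surjectivity and the Thom class
  have hconn : IsPreconnected ob.binding := hJ.isPreconnected_binding hP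
  have hsurj := ob.surjective_map_compl_binding_one ℚ
  obtain ⟨θ, hθ⟩ := ob.exists_forall_mem_span_localHomology_two ℚ hconn
  -- (3) the meridian
  obtain ⟨μ, hμ0, hμ⟩ := ob.exists_meridian_class ⟨0, ob.k_pos⟩ (circlePt 0)
  -- (4) exactness of `H₂(M, M ∖ B) → H₁(M ∖ B) → H₁(M)` and rank–nullity
  set i := singularHomology.map ℚ ℚ (subsetIncl (ob.binding)ᶜ) 1 with hi
  set δ := relativeSingularHomology.δ ℚ ℚ M (ob.binding)ᶜ 1 with hδ
  have hex : LinearMap.range δ.hom = LinearMap.ker i.hom :=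
    (relativeSingularHomology.exact_δ_map ℚ ℚ (X := M) (ob.binding)ᶜ 1).moduleCat_range_eq_ker
  have htop : (⊤ : Submodule ℚ (localHomologyOfSet ℚ ℚ M ob.binding 2)) =
      Submodule.span ℚ {θ} :=
    (eq_top_iff.2 fun x _ => hθ x).symm
  haveI : Module.Finite ℚ (localHomologyOfSet ℚ ℚ M ob.binding 2) := by
    rw [Module.finite_def, htop]
    exact Submodule.fg_span (Set.finite_singleton θ)
  have h2 : Module.finrank ℚ (localHomologyOfSet ℚ ℚ M ob.binding 2) ≤ 1 := by
    rw [← finrank_top, htop]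
    exact (finrank_span_le_card _).trans (by simp)
  have hker_le : Module.finrank ℚ (LinearMap.ker i.hom) ≤ 1 := by
    rw [← hex]
    exact (LinearMap.finrank_range_le δ.hom).trans h2
  have hker_ge : 1 ≤ Module.finrank ℚ (LinearMap.ker i.hom) := by
    have hμk : μ ∈ LinearMap.ker i.hom := LinearMap.mem_ker.2 hμ
    exact Module.finrank_pos_iff_exists_ne_zero.2
      ⟨⟨μ, hμk⟩, fun h => hμ0 (congrArg Subtype.val h)⟩
  have hrn := LinearMap.finrank_range_add_finrank_ker i.hom
  rw [LinearMap.range_eq_top.2 hsurj, finrank_top] at hrn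
  -- conclusion
  rw [bettiNumber_int_eq_rat, bettiNumber]
  omega

end Literature.Topology.FourManifolds
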